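import Summits.HodgeConjecture.HodgeConjecture.Theorems.R90S4BoxCharAdmissible     -- ★ p861485 (this seat) F1 `isAdmissible_boxChar` : the box of an admissible class is admissible
import Literature.NumberTheory.Automorphic.IrreducibleClassesComapSpherical           -- ★ F2 `IrrClass.IsAdmissible.comap` : admissibility along `IrrClass.comap e`
import Literature.NumberTheory.Automorphic.LocalUnitaryGroupCongr                     -- ★ `cmDatumLocalCongr` (conjugation by a local similitude), `cmDatum … .Local v`, `LocalRing`, `conjLocal`, `formCongr`
import HarnessLib

/-!
# R90-TF · S4 «Ch. 13.1–2» — socket S4#B1 `stub_R90_S4_H_admissible` PAID IN NAME-SHAPE: every member of an `H_v`-packet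
# `S = O ⊠ χ₁` (`O` a similitude orbit of an ADMISSIBLE class of `U(Φ₂)(L⁺_v)`, `χ₁` a smooth character of `U(Φ₁)(L⁺_v)`) is admissible

Cell `hodgecm-mathlib`, crux H413 (`stmt-HodgeConjecture-24833`, lane `--supports … --as helper`), route of record `HCCMUnconditional`
(no route verbs; count-neutral).  Programme R90-TF (HUMAN RULING «R90-TF SLAB — MAX PUSH»; brief `director/R90-BRIEF.v2.md`
1f40d54518340a35), section S4 = Rogawski Ch. 13.1–2 (base `R90-C131`); seat R90-C131-p01 (g0), dealt BY NAME «p01 → S4#B1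
`stub_R90_S4_H_admissible` (`Cruxes/H413/Lines/R90_S4_HPacketsU2B.lean` :318, ED. 1 sha16 251612dbcc286c69, BUILT gate87 BW157, AUDIT
S4#B1 CLEAN) — ROAD TRANSPORT» (`R90/S4/DEAL-S4-WAVE1.K2E2-plan-g6.md`, `R90/S4/DEAL-S4B-WAVE1.R90-C131-typ2-g0.md`).  THEOREMS ONLY
(one public theorem; no `def`, no instance, no notation, no named fact, no `sorry`); imports ★ only — in particular NO `Cruxes/…` import
(CONVENTIONS §2: a Theorems file imports `Mathlib ∕ Literature ∕ HarnessLib ∕ Statement ∕ Theorems ∕ Theses` only), whence: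

NAME-SHAPE (deal §Lane, second branch).  The socket reads, over file B's LOCAL vocabulary,
`∀ L … v (S : Finset (IrrClass (HLoc L v))), IsRogPacketH L v S → ∀ σ ∈ S, σ.IsAdmissible`;
here `HLoc`, `U2Loc`, `U1Loc`, `Φ₂Loc` (B :133–:145, `abbrev`s) and `IsU2SimilConj`, `IsRogPacketU2`, `IsRogPacketH` (B :150–:164, `def`s)
are UNFOLDED TO THEIR BODIES, BYTE FOR BYTE, so that the statement below is DEFINITIONALLY the socket's: the by-import probe
`example : type_of% @stub_R90_S4_H_admissible := @isAdmissible_of_isRogPacketH` elaborates (home probe `R90/R90-C131-p01/g0/probe.lean`,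
farm rc 0, 2026-09-04), i.e. file B's pen closes the socket at its next edition with `exact isAdmissible_of_isRogPacketH` (or the η-expanded
`fun L _ _ _ v S => isAdmissible_of_isRogPacketH L v S`).  Nothing is restated weaker or stronger.

MATHEMATICS (Rogawski §12.1 p. 171 «`ρ = ρ₁ ⊗ χ`, where `ρ₁` is a representation of `U(2)` and `χ` is a character of `U(1)`»; §11.1 p. 161
«an L-packet on `U(2)` is a `PGL₂(F)`-orbit»): a member of `S` is `σ = c ⊠ χ₁` with `c = σ₀ ∘ Ad(T)` (`IrrClass.comap` along the conjugation
★ `cmDatumLocalCongr L v T ha h : U(Φ₂)_v ≃ₜ* U(Φ₂)_v` by a similitude `T`, `ᵗT̄ Φ₂ T = a Φ₂`) for the ADMISSIBLE generator `σ₀` of the orbit `O`;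
admissibility is invariant under isomorphism of topological groups (F2 = ★ `IrrClass.IsAdmissible.comap`, `Automorphic/IrreducibleClassesComapSpherical`
:93: `V^{K′}(r ∘ e) = V^{e(K′)}(r)`) and passes to the box (F1 = ★ `isAdmissible_boxChar`, `Theorems/R90S4BoxCharAdmissible`, p861485:
`V^{K}((ρ ∘ pr₁) ⊗ (χ ∘ pr₂)) ≤ V^{pr₁(K ∩ ker(χ ∘ pr₂))}(ρ)`).  Proof = three `obtain`s and F1 ∘ F2.

HONEST LABEL: HC_CM is proved only modulo the 7 printed citations (2 remaining named inputs: hLiu418 = stmt-HodgeConjecture-24832,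
h413 = stmt-HodgeConjecture-24833) until rung 0 closes; this file pays ONE S4 socket (KH1′, the admissibility row of the H-side local kit)
and discharges no printed citation by itself.  REL ≠ ★ ≠ BUILT.

## References
[Rogawski1990] J. D. Rogawski, *Automorphic Representations of Unitary Groups in Three Variables*, Ann. of Math. Stud. 123 (1990), §11.1 p. 161,
§12.1 pp. 171–172 · [BushnellHenniart2006] C. J. Bushnell, G. Henniart, *The Local Langlands Conjecture for GL(2)*, Grundlehren 335 (2006),
§1.1–§2.1, §9.1 · [PlatonovRapinchuk1994] V. Platonov, A. Rapinchuk, *Algebraic Groups and Number Theory* (1994), §2.3 (similitudes).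
-/

set_option autoImplicit false
-- the mandated namespace (brief §3.4) repeats the single-problem summit's segment (`HodgeConjecture.HodgeConjecture`)
set_option linter.dupNamespace false

noncomputable section

open NumberField IsDedekindDomain
open scoped MatrixGroups
open Literature.NumberTheory.Automorphic Literature.NumberTheory.Automorphic.UnitaryGroup

namespace Summit.HodgeConjecture.HodgeConjecture.R90.S4

/-- **Socket S4#B1 (KH1′) in NAME-SHAPE — members of `H_v`-packets are admissible.**  For a CM field `L`, a finite place `v` of `L⁺`,
and a finset `S` of irreducible classes of `H_v = U(Φ₂)(L⁺_v) × U(Φ₁)(L⁺_v)` which IS AN `H_v`-PACKET in the sense of file B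
(`IsRogPacketH L v S`, unfolded: `S = O.map (· ⊠ χ₁)` for a smooth character `χ₁` of `U(Φ₁)(L⁺_v)` and a finset `O` which is the full
similitude-conjugation orbit `{σ₀ ∘ Ad(T) : ᵗT̄ Φ₂ T = a Φ₂, a ∈ (L ⊗ L⁺_v)ˣ}` of an ADMISSIBLE class `σ₀` of `U(Φ₂)(L⁺_v)`), every `σ ∈ S` is
admissible: `σ = (σ₀ ∘ Ad(T)) ⊠ χ₁`, ★ `IrrClass.IsAdmissible.comap` transports admissibility along `Ad(T)` (★ `cmDatumLocalCongr`) and ★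
`isAdmissible_boxChar` along `⊠ χ₁`.  The statement is the socket `stub_R90_S4_H_admissible` of `Cruxes/H413/Lines/R90_S4_HPacketsU2B.lean`
:318 with B's local `abbrev`∕`def`s `HLoc`, `U2Loc`, `U1Loc`, `Φ₂Loc`, `IsU2SimilConj`, `IsRogPacketU2`, `IsRogPacketH` unfolded to their
bodies byte for byte (definitionally equal; closes the socket by `exact`).  Informally (print): «if `ρ₁` is an admissible representation of
`U(2)` and `χ` a character of `U(1)` then `ρ = ρ₁ ⊗ χ` is an admissible representation of `H`; L-packets on `U(2)` are `PGL₂(F)`-orbits,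
and conjugation by `PGL₂(F)` preserves admissibility». [cite: Rogawski1990, §12.1 p. 171; §11.1 p. 161] [cite: BushnellHenniart2006, §2.1, §9.1] -/
theorem isAdmissible_of_isRogPacketH :
    ∀ (L : Type) [Field L] [NumberField L] [IsCMField L] (v : HeightOneSpectrum (𝓞 ↥(maximalRealSubfield L)))
      (S : Finset (IrrClass
        ((cmDatum L 2 (Matrix.of fun i j : Fin 2 => if i.val + j.val + 1 = 2 then (1 : L) else 0)).Local v ×
          (cmDatum L 1 (Matrix.of fun i j : Fin 1 => if i.val + j.val + 1 = 1 then (1 : L) else 0)).Local v))),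
      (∃ (O : Finset (IrrClass ((cmDatum L 2 (Matrix.of fun i j : Fin 2 => if i.val + j.val + 1 = 2 then (1 : L) else 0)).Local v)))
          (χ : (cmDatum L 1 (Matrix.of fun i j : Fin 1 => if i.val + j.val + 1 = 1 then (1 : L) else 0)).Local v →* ℂˣ)
          (hχ : IsOpen ((χ.ker : Subgroup ((cmDatum L 1 (Matrix.of fun i j : Fin 1 => if i.val + j.val + 1 = 1 then (1 : L) else 0)).Local v)) :
            Set ((cmDatum L 1 (Matrix.of fun i j : Fin 1 => if i.val + j.val + 1 = 1 then (1 : L) else 0)).Local v))),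
          (∃ σ : IrrClass ((cmDatum L 2 (Matrix.of fun i j : Fin 2 => if i.val + j.val + 1 = 2 then (1 : L) else 0)).Local v),
              σ.IsAdmissible ∧
                ∀ c, c ∈ O ↔
                  ∃ (T : GL (Fin 2) (LocalRing L v)) (a : LocalRing L v) (ha : IsUnit a)
                    (h : formCongr (conjLocal L (IsCMField.complexConj L) v) T
                        ((Matrix.of fun i j : Fin 2 => if i.val + j.val + 1 = 2 then (1 : L) else 0).map
                          (algebraMap L (LocalRing L v))) =
                      a • (Matrix.of fun i j : Fin 2 => if i.val + j.val + 1 = 2 then (1 : L) else 0).map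
                        (algebraMap L (LocalRing L v))),
                    c = IrrClass.comap (cmDatumLocalCongr L v T ha h) σ) ∧
            S = O.map ⟨IrrClass.boxChar χ hχ, IrrClass.boxChar_injective χ hχ⟩) →
      ∀ σ ∈ S, σ.IsAdmissible := by
  intro L _ _ _ v S hS σ hσ
  -- `S = O ⊠ χ`, `O` the similitude orbit of the admissible `σ₀`
  obtain ⟨O, χ, hχ, ⟨σ₀, hσ₀, hO⟩, rfl⟩ := hS
  -- `σ = c ⊠ χ` with `c ∈ O`
  obtain ⟨c, hc, rfl⟩ := Finset.mem_map.1 hσ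
  -- `c = σ₀ ∘ Ad(T)`
  obtain ⟨T, a, ha, h, rfl⟩ := (hO c).1 hc
  -- F1 ∘ F2
  exact isAdmissible_boxChar χ hχ (hσ₀.comap _)

end Summit.HodgeConjecture.HodgeConjecture.R90.S4

end
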